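import Summits.AnomalousDissipation.AnomalousDissipation.Theorems.SolenoidalFractalHomogenisationLagrangianStepSinePhase
import Literature.Analysis.FunctionSpaces.TorusFourierModes
import HarnessLib

/-!
# K1L_D (stmt-AnomalousDissipation-27980), line «onelevel-design», brick Z4♭: from COSINE single-mode bounds to all single real MODE PAIRS
# (helper; `--supports … --as helper`; lead-k1l-onelevel-p1 g4)

The assembly `…FlatBilinearAssembly.abs_inner_sub_le_sum_of_modewise` consumes a modewise bound for every weakly divergence-free `v ∈ V2` whose
coefficients live on one pair `{ℓ, −ℓ}`; the slow-vector clause (V) (read on a window in `…CellTimeModewise`) produces it for the COSINE data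
`Re(e_ℓ)•p`, `p ⊥ ℓ` real, and `…SinePhase` transfers it to `Im(e_ℓ)•p`.  THIS FILE closes the gap:
* `realTrigPoly_singleton_eq_cos_add_sin` — `Re(e_ℓ(x)•z) = Re(e_ℓ x)•Re z + Im(e_ℓ x)•Re(i z)` (real vectors `Re z`, `Re(iz) = −Im z`);
* `eq_toLp_realTrigPoly_of_pair` — a `V2` element supported on `{ℓ,−ℓ}` (`ℓ ≠ 0`) IS the single real mode `Re(e_ℓ • 2𝓕v(ℓ))`;
* `norm_realPart_add_norm_realPart_I_smul_le` — `‖Re z‖ + ‖Re(iz)‖ ≤ √2‖z‖`;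
* **`norm_fcoeff_sub_pair_le_of_cos`** — for linear `U, T` commuting with one translation `τ_h`, `Im e_ℓ(h) ≠ 0`, a cosine bound
  `‖𝓕(U x_c(p) − T x_c(p))(ℓ)‖ ≤ ε‖p‖` for all real `p ⊥ ℓ` gives `‖𝓕(U v − T v)(ℓ)‖ ≤ 2√2·ε·‖𝓕v(ℓ)‖` for every weakly divergence-free
  `v` supported on `{ℓ,−ℓ}`.
NOT a proof of Z4♭, of any registered stub, of the crux, or of AD; rung F-D1.A0.
-/

set_option linter.dupNamespace false  -- the summit-side namespace `Summit.AnomalousDissipation.AnomalousDissipation.…` repeats a component by design (D-0017)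

noncomputable section

namespace Summit.AnomalousDissipation.AnomalousDissipation.Theorems.SolenoidalFractalHomogenisation.LagrangianStep.PropagatorSymm

open Literature.Analysis Literature.Analysis.FluidPDE Literature.Analysis.FluidPDE.Torus Literature.Analysis.FunctionSpaces
open MeasureTheory Set Filter UnitAddTorus Function Complex
open scoped ENNReal NNReal InnerProductSpace
open OneLevelSplit

/-! ## Complex-vector bookkeeping -/

/-- `Re(e•z) = (Re e)•Re z + (Im e)•Re(i z)` for a scalar `e ∈ ℂ` and `z ∈ ℂ³`, read as real vectors. -/
theorem realPart_smul_eq (e : ℂ) (z : EuclideanSpace ℂ (Fin 3)) :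
    EuclideanSpace.realPart (e • z) = e.re • EuclideanSpace.realPart z + e.im • EuclideanSpace.realPart (I • z) := by
  ext i
  simp only [EuclideanSpace.realPart_apply, PiLp.smul_apply, PiLp.add_apply, smul_eq_mul, Complex.mul_re, Complex.I_re,
    Complex.I_im, zero_mul, one_mul, zero_sub]
  ring

/-- The single real mode splits into its cosine and sine parts with REAL vectors. -/
theorem realTrigPoly_singleton_eq_cos_add_sin (ℓ : Fin 3 → ℤ) (z : EuclideanSpace ℂ (Fin 3)) :
    FunctionSpaces.Torus.realTrigPoly {ℓ} (fun _ => z)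
      = fun x => (mFourier ℓ x).re • EuclideanSpace.realPart z + (mFourier ℓ x).im • EuclideanSpace.realPart (I • z) := by
  funext x
  rw [FunctionSpaces.Torus.realTrigPoly_singleton_apply, realPart_smul_eq]

/-- `‖Re z‖² + ‖Re(i z)‖² = ‖z‖²`. -/
theorem norm_sq_realPart_add (z : EuclideanSpace ℂ (Fin 3)) :
    ‖EuclideanSpace.realPart z‖ ^ 2 + ‖EuclideanSpace.realPart (I • z)‖ ^ 2 = ‖z‖ ^ 2 := by
  rw [EuclideanSpace.norm_sq_eq, EuclideanSpace.norm_sq_eq, EuclideanSpace.norm_sq_eq, ← Finset.sum_add_distrib]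
  refine Finset.sum_congr rfl fun i _ => ?_
  simp only [EuclideanSpace.realPart_apply, PiLp.smul_apply, smul_eq_mul, Complex.mul_re, Complex.I_re, Complex.I_im,
    zero_mul, one_mul, zero_sub, Real.norm_eq_abs, sq_abs, Complex.sq_norm, Complex.normSq_apply]
  ring

/-- `‖Re z‖ + ‖Re(i z)‖ ≤ √2 ‖z‖`. -/
theorem norm_realPart_add_norm_realPart_I_smul_le (z : EuclideanSpace ℂ (Fin 3)) :
    ‖EuclideanSpace.realPart z‖ + ‖EuclideanSpace.realPart (I • z)‖ ≤ Real.sqrt 2 * ‖z‖ := by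
  have h := norm_sq_realPart_add z
  have ha := norm_nonneg (EuclideanSpace.realPart z)
  have hb := norm_nonneg (EuclideanSpace.realPart (I • z))
  have hz := norm_nonneg z
  have h2 : (‖EuclideanSpace.realPart z‖ + ‖EuclideanSpace.realPart (I • z)‖) ^ 2 ≤ (Real.sqrt 2 * ‖z‖) ^ 2 := by
    rw [mul_pow, Real.sq_sqrt (by norm_num : (0:ℝ) ≤ 2)]
    nlinarith [sq_nonneg (‖EuclideanSpace.realPart z‖ - ‖EuclideanSpace.realPart (I • z)‖)]
  exact (pow_le_pow_iff_left₀ (by positivity) (by positivity) (by norm_num : (2:ℕ) ≠ 0)).1 h2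

/-- A divergence-free coefficient vector at `ℓ` gives cosine/sine vectors orthogonal to `ℓ`. -/
theorem inner_realPart_latticeVec_eq_zero {ℓ : Fin 3 → ℤ} {z : EuclideanSpace ℂ (Fin 3)} (hz : ∑ j, (ℓ j : ℂ) * z j = 0) :
    ⟪EuclideanSpace.realPart z, Torus.latticeVec ℓ⟫_ℝ = 0 ∧ ⟪EuclideanSpace.realPart (I • z), Torus.latticeVec ℓ⟫_ℝ = 0 := by
  have hre := congrArg Complex.re hz
  have him := congrArg Complex.im hz
  rw [Complex.re_sum, Complex.zero_re] at hre
  rw [Complex.im_sum, Complex.zero_im] at him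
  -- `⟪p, latticeVec ℓ⟫ = Σ_j ℓ_j p_j`
  have key : ∀ p : EuclideanSpace ℝ (Fin 3), (∑ i : Fin 3, (ℓ i : ℝ) * p i = 0) → ⟪p, Torus.latticeVec ℓ⟫_ℝ = 0 := by
    intro p hp
    rw [EuclideanSpace.inner_eq_star_dotProduct]
    simpa [dotProduct, Torus.latticeVec_apply, mul_comm] using hp
  constructor
  · refine key _ ?_
    rw [← hre]
    refine Finset.sum_congr rfl fun j _ => ?_
    simp [Complex.mul_re, EuclideanSpace.realPart_apply]
  · refine key _ ?_
    have : ∑ i : Fin 3, (ℓ i : ℝ) * (EuclideanSpace.realPart (I • z)) i = -∑ j, ((ℓ j : ℂ) * z j).im := by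
      rw [← Finset.sum_neg_distrib]
      refine Finset.sum_congr rfl fun j _ => ?_
      simp [Complex.mul_im, Complex.mul_re, EuclideanSpace.realPart_apply]
    rw [this, him, neg_zero]

/-! ## A `V2` element supported on a pair is a single real mode -/

/-- **Pair-supported elements are single real modes.**  For `ℓ ≠ 0` and `v ∈ V2` with `𝓕v(k) = 0` off `{ℓ, −ℓ}`:
`v = toLp (realTrigPoly {ℓ} (fun _ => 2•𝓕v(ℓ)))`. -/
theorem eq_toLp_realTrigPoly_of_pair {ℓ : Fin 3 → ℤ} (hℓ : ℓ ≠ 0) (v : V2)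
    (hv : ∀ k, k ≠ ℓ → k ≠ -ℓ → mFourierCoeff (EuclideanSpace.complexify ∘ ⇑v) k = 0) :
    v = (FunctionSpaces.Torus.memLp_realTrigPoly {ℓ} (fun _ => (2:ℂ) • mFourierCoeff (EuclideanSpace.complexify ∘ ⇑v) ℓ) 2).toLp _ := by
  refine eq_of_fcoeff_eq fun k => ?_
  rw [FunctionSpaces.Torus.mFourierCoeff_congr_ae (Filter.EventuallyEq.fun_comp (MemLp.coeFn_toLp _) EuclideanSpace.complexify) k,
    FunctionSpaces.Torus.mFourierCoeff_realTrigPoly_singleton]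
  have hℓℓ : ℓ ≠ -ℓ := fun h => hℓ (by
    have : (2:ℤ) • ℓ = 0 := by rw [two_zsmul]; nth_rewrite 2 [h]; exact add_neg_cancel ℓ
    exact (smul_eq_zero.1 this).resolve_left (by norm_num))
  by_cases h1 : k = ℓ
  · subst h1
    rw [if_pos rfl, if_neg hℓℓ, EuclideanSpace.conjVec_zero, add_zero, smul_smul]; norm_num
  · by_cases h2 : k = -ℓ
    · subst h2
      rw [if_neg h1, if_pos rfl, zero_add, EuclideanSpace.conjVec_smul, smul_smul, map_ofNat]
      have hsymm := FunctionSpaces.Torus.isConjSymm_mFourierCoeff (integrable_coe_V2 v) ℓ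
      simp only at hsymm
      rw [hsymm]; norm_num
    · rw [if_neg h1, if_neg h2, hv k h1 h2, EuclideanSpace.conjVec_zero, add_zero, smul_zero]


/-! ## From cosine bounds to pair data -/

variable (U T : V2 →L[ℝ] V2) (h : UnitAddTorus (Fin 3))
  (hU : ∀ x : V2, U (Lp.compMeasurePreserving (fun y : UnitAddTorus (Fin 3) => y + h) (measurePreserving_add_right volume h) x)
    = Lp.compMeasurePreserving (fun y : UnitAddTorus (Fin 3) => y + h) (measurePreserving_add_right volume h) (U x))
  (hT : ∀ x : V2, T (Lp.compMeasurePreserving (fun y : UnitAddTorus (Fin 3) => y + h) (measurePreserving_add_right volume h) x)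
    = Lp.compMeasurePreserving (fun y : UnitAddTorus (Fin 3) => y + h) (measurePreserving_add_right volume h) (T x))

include hU hT

/-- **Cosine bounds give pair-data bounds.**  For linear `U, T` commuting with `τ_h`, `Im e_ℓ(h) ≠ 0`, `ℓ ≠ 0`, `0 ≤ ε`: if
`‖𝓕(U x_c(p) − T x_c(p))(ℓ)‖ ≤ ε‖p‖` for every real `p ⊥ ℓ` (`x_c(p) = toLp (Re(e_ℓ)•p)`), then every weakly divergence-free `v ∈ V2` supported on
`{ℓ, −ℓ}` obeys `‖𝓕(U v − T v)(ℓ)‖ ≤ 2√2·ε·‖𝓕v(ℓ)‖`. -/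
theorem norm_fcoeff_sub_pair_le_of_cos {ℓ : Fin 3 → ℤ} (hℓ : ℓ ≠ 0) (him : (mFourier ℓ h).im ≠ 0) {ε : ℝ} (hε : 0 ≤ ε)
    (hcos : ∀ p : EuclideanSpace ℝ (Fin 3), ⟪p, Torus.latticeVec ℓ⟫_ℝ = 0 →
      ‖mFourierCoeff (EuclideanSpace.complexify ∘ ⇑(U ((memLp_cosMode ℓ p).toLp _) - T ((memLp_cosMode ℓ p).toLp _))) ℓ‖ ≤ ε * ‖p‖)
    (v : V2) (hvdiv : v ∈ divFreeL2 (Fin 3))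
    (hv : ∀ k, k ≠ ℓ → k ≠ -ℓ → mFourierCoeff (EuclideanSpace.complexify ∘ ⇑v) k = 0) :
    ‖mFourierCoeff (EuclideanSpace.complexify ∘ ⇑(U v - T v)) ℓ‖
      ≤ 2 * Real.sqrt 2 * ε * ‖mFourierCoeff (EuclideanSpace.complexify ∘ ⇑v) ℓ‖ := by
  set z : EuclideanSpace ℂ (Fin 3) := (2:ℂ) • mFourierCoeff (EuclideanSpace.complexify ∘ ⇑v) ℓ with hz_def
  set p₁ : EuclideanSpace ℝ (Fin 3) := EuclideanSpace.realPart z with hp₁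
  set q : EuclideanSpace ℝ (Fin 3) := EuclideanSpace.realPart (I • z) with hq
  -- transversality of `p₁`, `q`
  have hdivz : ∑ j, (ℓ j : ℂ) * z j = 0 := by
    have h0 := FunctionSpaces.Torus.IsWeaklyDivFree.sum_mul_mFourierCoeff_eq_zero (Lp.memLp v) ((mem_divFreeL2_iff v).1 hvdiv) ℓ
    rw [hz_def]
    simp only [PiLp.smul_apply, smul_eq_mul]
    rw [show ∑ j, (ℓ j : ℂ) * (2 * mFourierCoeff (EuclideanSpace.complexify ∘ ⇑v) ℓ j)
        = 2 * ∑ j, (ℓ j : ℂ) * mFourierCoeff (EuclideanSpace.complexify ∘ ⇑v) ℓ j by rw [Finset.mul_sum]; ring_nf, h0, mul_zero]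
  obtain ⟨hp₁ℓ, hqℓ⟩ := inner_realPart_latticeVec_eq_zero hdivz
  -- `v = x_c(p₁) + x_s(q)`
  have hvsplit : v = (memLp_cosMode ℓ p₁).toLp _ + (memLp_sinMode ℓ q).toLp _ := by
    rw [eq_toLp_realTrigPoly_of_pair hℓ v hv, ← MemLp.toLp_add]
    exact MemLp.toLp_congr _ _ (Filter.Eventually.of_forall fun x => by
      rw [realTrigPoly_singleton_eq_cos_add_sin]; rfl)
  -- linearity, the sine phase, the cosine bounds
  have e : U v - T v = (U ((memLp_cosMode ℓ p₁).toLp _) - T ((memLp_cosMode ℓ p₁).toLp _))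
      + (U ((memLp_sinMode ℓ q).toLp _) - T ((memLp_sinMode ℓ q).toLp _)) := by
    rw [hvsplit, map_add, map_add]; abel
  rw [e, fcoeff_add]
  refine (norm_add_le _ _).trans ?_
  rw [norm_fcoeff_sub_sinMode_eq U T h hU hT ℓ q him]
  refine (add_le_add (hcos p₁ hp₁ℓ) (hcos q hqℓ)).trans ?_
  rw [← mul_add]
  have hsum := norm_realPart_add_norm_realPart_I_smul_le z
  have hz2 : ‖z‖ = 2 * ‖mFourierCoeff (EuclideanSpace.complexify ∘ ⇑v) ℓ‖ := by
    rw [hz_def, norm_smul]; norm_num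
  calc ε * (‖p₁‖ + ‖q‖) ≤ ε * (Real.sqrt 2 * ‖z‖) := mul_le_mul_of_nonneg_left hsum hε
    _ = 2 * Real.sqrt 2 * ε * ‖mFourierCoeff (EuclideanSpace.complexify ∘ ⇑v) ℓ‖ := by rw [hz2]; ring

end Summit.AnomalousDissipation.AnomalousDissipation.Theorems.SolenoidalFractalHomogenisation.LagrangianStep.PropagatorSymm

end
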